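import Literature.MathematicalPhysics.QuantumFieldTheory.Federbush1986.AbelianModeEstimates

/-!
# Federbush I §1 «Averaging» — a CONCRETE inhabitant of the carrier `AbelianAveraging`: Bałaban's block averaging
# (1.8) of [Balaban1984PropagatorsI] in Federbush's setting (lattices `(2^{−r}ℤ)⁴`, blocks of `2⁴` vertices with the base
# point at a corner, real bond variables), for ONE admissible choice of the maximal trees (the axial trees)

statement-level skeleton of published theorems with citation tags; proofs where landed; nothing here is a claim about the Yang–Mills mass gap

Cell `lit-balaban`, reader/typer block **r17 = Federbush**; companion to `Federbush1986/AbelianModeEstimates.lean` (p239224), whose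
structure `AbelianAveraging` carries Bałaban's averaging between levels ABSTRACTLY (F6 note there: «the maximal trees are a hidden
choice»).  This file DEFINES the averaging for the axial trees and PROVES the two carrier axioms (`av_self`, cascade `av_trans`), so
that every predicate of that file (`ModeEstimates`, `Eq206`, …, `LatticeActionsConverge`) has a closed instance
`axialTreeAveraging.ModeEstimates`, … .  Row F1.Eq1.10-1.11 of `run/shared/lean/pub/lit-balaban/lit-balaban-r17/SKELETON-r17.md`.

**Source, verbatim.** P. Federbush, CMP **107** (1986) [bib `Federbush1986PhaseCellI`], §1 p. 321–322 (renders `…/b2b-balaban-t4-lit2/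
renders/fed1986/fed1986-cmp107-p003|p004-x2.png` read as images): «To each vertex in ℒ^r, there is associated a vertex in ℒ^{r+1}
(the same point in R⁴), the "base point" of a "block" of 2⁴ vertices in ℒ^{r+1}. (Here the base point will be a corner of the
block, for ℓ_r = 1/N^r other locations of base points are possible, which leads again to trivial modifications.) … Averaging
(we refer to as Balaban averaging) is defined in Eq. (1.8) of [1]. We establish a maximal tree in each block. We let x be a
point in one of the blocks, x′ the corresponding point in the other block. Γ_x is a path between base points, along portions of
the maximal trees and a straight line segment joining x and x′. If we pick the maximal trees in Fig. 1 to be composed of e_a,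
e_c, e_e, and e_g, e_p e_t in the two blocks, we may write in a natural notation A(e) = ¼(A_{Γ1} + A_{Γ2} + A_{Γ3} + A_{Γ4}), (1.1)
… In general, A(e) is the average over the A_{Γ_x}. (For any oriented path, A_Γ = Σ_{Γ_i} A(e_i), where Γ is composed of the
e_{α_i} with proper orientations.)» and p. 325: «The bond assignments are not so easy to come by, they depend on the particular
(arbitrary) choice of maximal tree in each block.»  [1] = T. Bałaban, CMP **95** (1984) 17–40 [`Balaban1984PropagatorsI`], (1.8) p. 19.

**What is defined (d = 4, N = 2, corner base points, as printed; the tree is OUR admissible choice).**  Index-free bond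
configurations `Cfg = (ℤ⁴ → direction → ℝ)`; the AXIAL maximal tree of a block: from the base point `b` to `b + δ`
(`δ ∈ {0,1}⁴`) step through the coordinates in the order 0, 1, 2, 3 (`treeSum`); the path `Γ_x` for the coarse edge
(`b`, `μ`): tree path `2b → x = 2b + δ`, the straight segment `x → x + e_μ → x + 2e_μ = x′` (two fine edges), and the tree
path of the block based at `2b + 2e_μ` from `x′` back to its base point, reversed (`pathSum`); the one-step average
`avStep c (b, μ) = 2^{−4} Σ_δ A(Γ_{2b+δ})` ((1.1)/(1.10)); the many-step average by iteration (the «cascade», (1.11)); and the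
inhabitant `axialTreeAveraging : AbelianAveraging` with `av s r = avStep^{r−s}` for `s ≤ r` (junk `0` for `s > r`, as the
carrier's docstring allows).  PROVED: `av_self`, `av_trans` (iteration adds up).  NOT claimed: that another admissible tree
gives the same bond assignments (print: it does not; only the plaquette assignments are tree-independent, p. 325).
-/

namespace Literature.MathematicalPhysics.QuantumFieldTheory.Federbush1986

noncomputable section

open scoped BigOperators

namespace AxialTree

/-- Index-free real bond configurations on `ℤ⁴ × {directions}` (the level index `r` of `Edge r` is a phantom: the same
integer data describe a configuration at every level). [cite: Federbush1986PhaseCellI, §1 p. 321] -/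
def Cfg : Type := (Fin 4 → ℤ) → Fin 4 → ℝ

/-- Forget the level index. [cite: Federbush1986PhaseCellI, §1 p. 321] -/
def toCfg {r : ℕ} (a : Edge r → ℝ) : Cfg := fun b μ => a ⟨b, μ⟩

/-- Reinstate a level index. [cite: Federbush1986PhaseCellI, §1 p. 321] -/
def ofCfg {r : ℕ} (c : Cfg) : Edge r → ℝ := fun e => c e.base e.dir

/-- `ofCfg ∘ toCfg = id`. [cite: Federbush1986PhaseCellI, §1 p. 321] -/
theorem ofCfg_toCfg {r : ℕ} (a : Edge r → ℝ) : ofCfg (toCfg a) = a := by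
  funext e; cases e; rfl

/-- `toCfg ∘ ofCfg = id`. [cite: Federbush1986PhaseCellI, §1 p. 321] -/
theorem toCfg_ofCfg {r : ℕ} (c : Cfg) : toCfg (ofCfg (r := r) c) = c := by
  funext b μ; rfl

/-- The sum of the bond variables along the AXIAL maximal-tree path of a block from its base point `b` to the block vertex
`b + δ` (`δ ∈ {0,1}⁴`): the coordinates are stepped in the order 0, 1, 2, 3 («We establish a maximal tree in each block» —
this is one admissible choice; print's Fig. 1 trees are another). [cite: Federbush1986PhaseCellI, §1 p. 321–322, Fig. 1–2] -/
def treeSum (c : Cfg) (b : Fin 4 → ℤ) (δ : Fin 4 → Bool) : ℝ :=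
  ∑ k : Fin 4, if δ k then
    c (b + ∑ j ∈ Finset.univ.filter (fun j => j < k ∧ δ j = true), Pi.single j 1) k else 0

/-- `A(Γ_x)` for the coarse edge with base `b` and direction `μ` and the block vertex `x = 2b + δ`: «Γ_x is a path between base
points, along portions of the maximal trees and a straight line segment joining x and x′» — tree path `2b → x`, the two
fine edges `x → x + e_μ → x + 2e_μ = x′`, and (reversed) the tree path of the block based at `2b + 2e_μ` from its base to `x′`.
[cite: Federbush1986PhaseCellI, (1.1)–(1.2) p. 321–322; Balaban1984PropagatorsI, (1.8) p. 19] -/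
def pathSum (c : Cfg) (b : Fin 4 → ℤ) (μ : Fin 4) (δ : Fin 4 → Bool) : ℝ :=
  let b2 : Fin 4 → ℤ := fun k => 2 * b k
  let x : Fin 4 → ℤ := b2 + fun k => if δ k then 1 else 0
  treeSum c b2 δ + c x μ + c (x + Pi.single μ 1) μ - treeSum c (b2 + Pi.single μ 2) δ

/-- The one-step Bałaban average, level `r + 1 → r`, block `2⁴`, corner base points: «A(e) is the average over the A_{Γ_x}»,
`A(e) = 2^{−4} Σ_{x ∈ block} A(Γ_x)` ((1.1) in the 2-d picture: «A(e) = ¼(A_{Γ1} + A_{Γ2} + A_{Γ3} + A_{Γ4})»; (1.10)).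
[cite: Federbush1986PhaseCellI, (1.1) p. 322, (1.10) p. 323; Balaban1984PropagatorsI, (1.8) p. 19] -/
def avStep (c : Cfg) : Cfg := fun b μ => (1 / 16 : ℝ) * ∑ δ : Fin 4 → Bool, pathSum c b μ δ

end AxialTree

open AxialTree in
/-- **The inhabitant**: Bałaban's abelian block averaging between the levels of `(2^{−r}ℤ)⁴` with the axial maximal trees, as
an `AbelianAveraging` — `av s r` = the `(r − s)`-fold iterate of the one-step average («By iterating we obtain a similar
formula for A_Γ as an average over paths in ℒ^s, s > r», (1.11)); `av_self` and the cascade property `av_trans` PROVED.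
With it every typed statement of `AbelianModeEstimates` has a closed instance, e.g. `axialTreeAveraging.ModeEstimates`.
[cite: Federbush1986PhaseCellI, §1 (1.1), (1.10)–(1.11) p. 321–324; §2 p. 325] -/
def axialTreeAveraging : AbelianAveraging where
  av s r a := if s ≤ r then ofCfg (avStep^[r - s] (toCfg a)) else fun _ => 0
  av_self r a := by
    simp only [le_refl, if_true, Nat.sub_self, Function.iterate_zero, id_eq]
    exact ofCfg_toCfg a
  av_trans s q r hsq hqr a := by
    simp only [if_pos hsq, if_pos hqr, if_pos (le_trans hsq hqr), toCfg_ofCfg]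
    rw [← Function.iterate_add_apply]
    congr 2
    omega

/-- Unfolding: for `s ≤ r` the average is the `(r − s)`-fold iterate of `avStep`. [cite: Federbush1986PhaseCellI, (1.10)–(1.11)
p. 323–324] -/
theorem axialTreeAveraging_av_of_le {s r : ℕ} (h : s ≤ r) (a : Edge r → ℝ) :
    axialTreeAveraging.av s r a = AxialTree.ofCfg (AxialTree.avStep^[r - s] (AxialTree.toCfg a)) := by
  simp [axialTreeAveraging, h]

/-- One step: `av r (r+1) a = avStep a` (up to the level bookkeeping). [cite: Federbush1986PhaseCellI, (1.1), (1.10) p. 322–323] -/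
theorem axialTreeAveraging_av_succ (r : ℕ) (a : Edge (r + 1) → ℝ) :
    axialTreeAveraging.av r (r + 1) a = AxialTree.ofCfg (AxialTree.avStep (AxialTree.toCfg a)) := by
  rw [axialTreeAveraging_av_of_le (Nat.le_succ r)]
  simp

end

end Literature.MathematicalPhysics.QuantumFieldTheory.Federbush1986
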